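import Summits.QuantumFields.YangMills.Theorems.UnitScaleTiltProp8FlatCubeOpsText
import HarnessLib

/-!
# Route `UnitScaleTilt`, crux K1 child «MinimiserStabilityRegPr» (stmt-QuantumFields-19200), registered stub V2′ `stub_halvingStep`
# (skeleton v7 cc37a17877262141) — **[Balaban1985Variational] (161) ⇒ (163) ⇒ (164) IN THE P2 TEXT'S LETTERS**: the datum term
# `|HB| ≤ ¼M_Δ max{B₃ε₁, ½ε₀}` of (165)/(167) from the registered P2 letters `FlatCubeOpsText.HDecayLetterD` ((161)₁, four rows) and
# `FlatCubeOpsText.RowSum162` ((162)) — whose supplier at the d = 3 carrier is the `FlatPort` bridge over lit-balaban's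
# `B6Cor28EntriesKLevelV1L0.cor28_kLevel_H_DH` (G-F3′-L0, p577377), consumed BY NAME there

Cell `ym3-torus` (HUMAN RULING D-0037, YM ladder rung R3 — continuum SU(2) YM₃ on the torus is a RUNG, not the Clay problem), width seat
`ym-ust-19200-w3` gen 0 (D-0149; OWNER W-SEAT START LIST 2026-08-27T22:29:16Z «w3 = `stub_halvingStep` … P2 `FlatOpsAdmAt` consumes cor28 by name»).
`--supports stmt-QuantumFields-19200 --as helper`; def-free, 0 sorry, standard axioms.  Companion of `Prop8LastMile` (p582419): there the registered
stub is reduced BY NAME to the (167)-chart schema; (167) = (164) [THIS FILE, from P2's letters] + the second-order terms of (165) (F4's (158) solution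
`FlatSmallSolution158CubeSeq.letter_solution158_dom_le` + P3) under (166).

THE PRINT (p. 303 [PDF 27]): *«This bound [(160)] and the global bound (152) imply the following bounds on the cube Δ(y₁), Δ(y₁) = Δ₀ or y₁ ∈ □,
|HB|, |∇^ηHB|, |∂^{η*}∂^ηHB|, |Δ^ηHB| ≦ B₀ Σ_{c∈ℭ_k} e^{−δ₀d(y₁,c₋)}(L^{j(c)}η)^{−1}|B(c)| < … ≦ 18d³L³B₀ Σ_{y₂∈ℭ_k} e^{−½δ₀d(y₁,y₂)}(d(y₁,y₂) + 1)
(L^{j₂}η)^{−1} · M_Δ max{ε₁, e^{−½δ₀R₁M₁}ε₀}, (161) … It is now clear how we should define B₃. Let us take B₃ = 72d³L³B₀ sup_{y₁} Σ_{y₂∈ℭ_k}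
e^{−½δ₀d(y₁,y₂)}(d(y₁,y₂) + 1)(L^{j₂}η)^{−1}. (162) It follows from the inequalities (2.47)–(2.51) of [3] that B₃ depends on d and L only.»*
p. 304: *«We may assume that R₁M₁ is sufficiently big, so that B₃e^{−½δ₀R₁M₁} ≦ ½. (163) Then we get on Δ  |HB|, |∇^ηHB|, |∂^{η*}∂^ηHB|, |Δ^ηHB| <
¼M_Δ max{B₃ε₁, ½ε₀}. (164)»*  (The near/far split of member 2 — (160) on `□′_k^{(k−1)} ∪ □″_k^{(k)}`, (155) `|B| < 18d²L³Mε₀` beyond distance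
`R₁M₁` by (144) — is kernel-checked over the abstract geometry of [3] in lit-balaban's `B11Eq161HBChain`; here the same chain is written over the
P2 TEXT's letters at the d = 3 carrier, with the geometric facts (triangle inequality, separation) as the hypotheses `hnear`/`hfar`.)

WHAT THIS FILE PROVES (`D : Domains (F.P K)` any nested family, `w` any weights with `0 ≤ w 1 b`, `dBI` any distance; `j(c) = c.1.1`, `η = L^{−(K−n)}`):
* §1 `exp_split` / `kernelTerm_le` / `kernelSum_le_rowSum` — the half-rate split `e^{−δ₀d} = e^{−½δ₀d}·e^{−½δ₀d}` and (161)₁ ⇒ (161)₅ termwise: if the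
  EFFECTIVE DATUM seen from `b` obeys `e^{−½δ₀d(b,c)}|X(c)| ≤ β·(d(b,c) + 1)·L^{(K−n)−j(c)}` for every index bond `c`, then
  `Σ_c e^{−δ₀d(b,c)}|X(c)| ≤ β·Σ_c e^{−½δ₀d(b,c)}(d(b,c) + 1)L^{(K−n)−j(c)}`.
* §2 `effDatum_of_near_far` — member 1 ≦ member 4 of (161): the effective-datum bound from a NEAR bound `|X(c)| ≤ β₁(d(b,c) + 1)L^{(K−n)−j(c)}` ((160)
  after the located triangle inequality) and a FAR bound `|X(c)| ≤ β₂L^{(K−n)−j(c)}` at distance `d(b,c) ≥ R` ((155) + (144)), with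
  `β = max{β₁, e^{−½δ₀R}β₂}`.
* §3 `rows164_of_hDecayLetterD` — **(161) ⇒ (161)₅·B₃ IN P2's LETTERS**: `HDecayLetterD dBI w H B₀ δ₀` ∧ `RowSum162 dBI w δ₀ B₃` ∧ the effective-datum
  bound at `b` ⇒ the four left-weighted rows `w₁(b)·(w₁(b)|HX(b)|)`, `w₁(b)·(w₂(b)Lᵏ|∇HX(b)|)`, `w₁(b)·(w₃(b)|∂*∂HX(b)|)`, `w₁(b)·(w₃(b)L²ᵏ|ΔHX(b)|)`
  are `≤ B₀·B₃·β` (at a top-level bond `w₁(b) = 1` and these are the four quantities of (164)).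
* §4 `quarter164_arith` — **(162)–(163) ⇒ (164)**: with print's `B₃′ := 4·C·B₀·B₃` (our `B₃` = the row-sum bound, print's B₃ absorbs `18d³L³B₀`, `C` the
  datum constant) and `β = C·M_Δ·max{ε₁, θε₀}`, `B₃′θ ≤ ½` ((163), `θ = e^{−½δ₀R₁M₁}`): `B₀·B₃·β ≤ ¼M_Δ·max{B₃′ε₁, ½ε₀}`;
  `rows164_quarter` — §3 + §4 composed: the four rows `< or ≤ ¼M_Δ max{B₃′ε₁, ½ε₀}` (164).

HONEST SCOPE: (160), (155), (152), the cube-sequence geometry (144) and the operators themselves are NOT proved here — they enter as the hypotheses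
`hnear`/`hfar` and as P2's letters; the file is the by-name junction «P2 text ⟹ the ¼-term of (167)».  No definition, no sorry, standard axioms.
NOT a claim about the crux, the rung, or the mass gap.

References: T. Bałaban, CMP **102** (1985) 277–309 [Balaban1985Variational] (155) p.302, (160)–(163) p.303, (164)–(165) p.304;
CMP **96** (1984) 223–250 [Balaban1984PropagatorsII] (2.46)–(2.51) p.231, Cor. 2.8 (2.150)–(2.151) p.249.
-/

set_option autoImplicit false

noncomputable section

open scoped BigOperators

namespace Summit.QuantumFields.YangMills.Theorems.FlatHBBound164

open Literature.MathematicalPhysics.QuantumFieldTheory.Balaban1983to89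
open B6SectADomainsV1 (Domains)
open B6SectAOperatorsV1 (BondIdx dcE dcsE)
open T3ContinuumYM3Torus (T3Family)
open Summit.QuantumFields.YangMills.Theorems.FlatCubeOpsText (HDecayLetterD RowSum162)

/-! ## §1 The half-rate split and the termwise domination (161)₁ ⇒ (161)₅ -/

/-- `e^{−δ₀d} = e^{−½δ₀d}·e^{−½δ₀d}` (members 2 → 3 of (161)). [cite: Balaban1985Variational, (161) p.303] -/
theorem exp_split (δ₀ d : ℝ) : Real.exp (-(δ₀ * d)) = Real.exp (-(δ₀ / 2 * d)) * Real.exp (-(δ₀ / 2 * d)) := by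
  rw [← Real.exp_add]; ring_nf

/-- One term of (161): `e^{−δ₀d}|X(c)| ≤ β·e^{−½δ₀d}(d + 1)L^{(K−n)−j(c)}` from the effective-datum bound `e^{−½δ₀d}|X(c)| ≤ β(d + 1)L^{(K−n)−j(c)}`.
[cite: Balaban1985Variational, (161) p.303] -/
theorem kernelTerm_le {δ₀ d x β ℓ : ℝ} (hx : Real.exp (-(δ₀ / 2 * d)) * |x| ≤ β * ((d + 1) * ℓ)) :
    Real.exp (-(δ₀ * d)) * |x| ≤ β * (Real.exp (-(δ₀ / 2 * d)) * (d + 1) * ℓ) := by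
  rw [exp_split, mul_assoc]
  calc Real.exp (-(δ₀ / 2 * d)) * (Real.exp (-(δ₀ / 2 * d)) * |x|)
      ≤ Real.exp (-(δ₀ / 2 * d)) * (β * ((d + 1) * ℓ)) := mul_le_mul_of_nonneg_left hx (Real.exp_nonneg _)
    _ = β * (Real.exp (-(δ₀ / 2 * d)) * (d + 1) * ℓ) := by ring

section Carrier

variable {F : T3Family} {n K : ℕ} {D : Domains (F.P K)}

/-- **(161)₁ ⇒ (161)₅, THE KERNEL SUM**: under the effective-datum bound at the fine bond `b`, `Σ_c e^{−δ₀d(b,c)}|X(c)| ≤ β·Σ_c e^{−½δ₀d(b,c)}(d(b,c) + 1)L^{(K−n)−j(c)}`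
— the inner sum of (162). [cite: Balaban1985Variational, (161)–(162) p.303] -/
theorem kernelSum_le_rowSum (dBI : PBond (F.P K) 0 → BondIdx D → ℝ) {δ₀ β : ℝ} (X : BondIdx D → ℝ) (b : PBond (F.P K) 0)
    (hX : ∀ c : BondIdx D, Real.exp (-(δ₀ / 2 * dBI b c)) * |X c| ≤ β * ((dBI b c + 1) * (F.L : ℝ) ^ ((K - n) - (c.1.1 : ℕ)))) :
    ∑ c, Real.exp (-(δ₀ * dBI b c)) * |X c| ≤
      β * ∑ c, Real.exp (-(δ₀ / 2 * dBI b c)) * (dBI b c + 1) * (F.L : ℝ) ^ ((K - n) - (c.1.1 : ℕ)) := by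
  rw [Finset.mul_sum]
  exact Finset.sum_le_sum fun c _ => kernelTerm_le (hX c)

/-! ## §2 The effective datum from the near/far split (members 1 → 4 of (161)) -/

/-- **THE EFFECTIVE DATUM FROM (160) NEAR AND (155) FAR** (members 1 ≦ 4 of (161)): if on the NEAR index bonds `|X(c)| ≤ β₁(d(b,c) + 1)L^{(K−n)−j(c)}`
((160) `|B(x,x′)| < (8d²L² + 4L²|x − y|)ε₁` after `|x − y| ≤ d(b,c) + 3d²M_Δ`) and on the FAR ones `|X(c)| ≤ β₂L^{(K−n)−j(c)}` with `R ≤ d(b,c)` ((155)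
`|B| < 18d²L³Mε₀` and the (144)-separation `dist ≥ R₁M₁`), `0 ≤ β₂`, `0 ≤ δ₀`, `0 ≤ d`, then the effective-datum bound holds with
`β = max{β₁, e^{−½δ₀R}β₂}`. [cite: Balaban1985Variational, (155) p.302, (160)–(161) p.303, (144) p.300] -/
theorem effDatum_of_near_far (dBI : PBond (F.P K) 0 → BondIdx D → ℝ) {δ₀ β₁ β₂ R : ℝ} (hδ₀ : 0 ≤ δ₀) (hβ₂ : 0 ≤ β₂)
    (near : BondIdx D → Prop) (X : BondIdx D → ℝ) (b : PBond (F.P K) 0) (hd : ∀ c, 0 ≤ dBI b c)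
    (hnear : ∀ c, near c → |X c| ≤ β₁ * ((dBI b c + 1) * (F.L : ℝ) ^ ((K - n) - (c.1.1 : ℕ))))
    (hfar : ∀ c, ¬ near c → |X c| ≤ β₂ * (F.L : ℝ) ^ ((K - n) - (c.1.1 : ℕ)) ∧ R ≤ dBI b c) :
    ∀ c : BondIdx D, Real.exp (-(δ₀ / 2 * dBI b c)) * |X c| ≤
      max β₁ (Real.exp (-(δ₀ / 2 * R)) * β₂) * ((dBI b c + 1) * (F.L : ℝ) ^ ((K - n) - (c.1.1 : ℕ))) := by
  intro c
  have hL0 : (0 : ℝ) ≤ (F.L : ℝ) ^ ((K - n) - (c.1.1 : ℕ)) := by positivity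
  have hd1 : (0 : ℝ) ≤ dBI b c + 1 := by linarith [hd c]
  have hprod : 0 ≤ (dBI b c + 1) * (F.L : ℝ) ^ ((K - n) - (c.1.1 : ℕ)) := mul_nonneg hd1 hL0
  have hexp1 : Real.exp (-(δ₀ / 2 * dBI b c)) ≤ 1 := by
    rw [Real.exp_le_one_iff]; nlinarith [hd c]
  by_cases hc : near c
  · calc Real.exp (-(δ₀ / 2 * dBI b c)) * |X c| ≤ 1 * |X c| :=
          mul_le_mul_of_nonneg_right hexp1 (abs_nonneg _)
      _ ≤ β₁ * ((dBI b c + 1) * (F.L : ℝ) ^ ((K - n) - (c.1.1 : ℕ))) := by rw [one_mul]; exact hnear c hc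
      _ ≤ max β₁ (Real.exp (-(δ₀ / 2 * R)) * β₂) * ((dBI b c + 1) * (F.L : ℝ) ^ ((K - n) - (c.1.1 : ℕ))) :=
          mul_le_mul_of_nonneg_right (le_max_left _ _) hprod
  · obtain ⟨hXc, hR⟩ := hfar c hc
    have hexpR : Real.exp (-(δ₀ / 2 * dBI b c)) ≤ Real.exp (-(δ₀ / 2 * R)) := by
      rw [Real.exp_le_exp]; nlinarith
    calc Real.exp (-(δ₀ / 2 * dBI b c)) * |X c|
        ≤ Real.exp (-(δ₀ / 2 * R)) * (β₂ * (F.L : ℝ) ^ ((K - n) - (c.1.1 : ℕ))) :=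
          mul_le_mul hexpR hXc (abs_nonneg _) (Real.exp_nonneg _)
      _ = (Real.exp (-(δ₀ / 2 * R)) * β₂) * (1 * (F.L : ℝ) ^ ((K - n) - (c.1.1 : ℕ))) := by ring
      _ ≤ (Real.exp (-(δ₀ / 2 * R)) * β₂) * ((dBI b c + 1) * (F.L : ℝ) ^ ((K - n) - (c.1.1 : ℕ))) :=
          mul_le_mul_of_nonneg_left (mul_le_mul_of_nonneg_right (by linarith [hd c]) hL0)
            (mul_nonneg (Real.exp_nonneg _) hβ₂)
      _ ≤ max β₁ (Real.exp (-(δ₀ / 2 * R)) * β₂) * ((dBI b c + 1) * (F.L : ℝ) ^ ((K - n) - (c.1.1 : ℕ))) :=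
          mul_le_mul_of_nonneg_right (le_max_right _ _) hprod

/-! ## §3 (161) in P2's letters: the four rows of `HDecayLetterD` × the row sum `RowSum162` -/

/-- One row: `w₁(b)·Q ≤ w₁(b)·B₀Σ_c e^{−δ₀d}|X(c)| ≤ B₀·β·(w₁(b)Σ_c e^{−½δ₀d}(d+1)L^{…}) ≤ B₀·B₃·β`. [cite: Balaban1985Variational, (161)–(162) p.303] -/
theorem row_le_of_kernel {dBI : PBond (F.P K) 0 → BondIdx D → ℝ} {w : ℕ → PBond (F.P K) 0 → ℝ} {δ₀ B₀ B₃ β Q : ℝ}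
    (h162 : RowSum162 F n K D dBI w δ₀ B₃) (hB₀ : 0 ≤ B₀) (hβ : 0 ≤ β) {X : BondIdx D → ℝ} {b : PBond (F.P K) 0} (hwb : 0 ≤ w 1 b)
    (hX : ∀ c : BondIdx D, Real.exp (-(δ₀ / 2 * dBI b c)) * |X c| ≤ β * ((dBI b c + 1) * (F.L : ℝ) ^ ((K - n) - (c.1.1 : ℕ))))
    (hQ : Q ≤ B₀ * ∑ c, Real.exp (-(δ₀ * dBI b c)) * |X c|) :
    w 1 b * Q ≤ B₀ * B₃ * β := by
  have hsum := kernelSum_le_rowSum dBI X b hX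
  calc w 1 b * Q ≤ w 1 b * (B₀ * ∑ c, Real.exp (-(δ₀ * dBI b c)) * |X c|) := mul_le_mul_of_nonneg_left hQ hwb
    _ ≤ w 1 b * (B₀ * (β * ∑ c, Real.exp (-(δ₀ / 2 * dBI b c)) * (dBI b c + 1) * (F.L : ℝ) ^ ((K - n) - (c.1.1 : ℕ)))) :=
        mul_le_mul_of_nonneg_left (mul_le_mul_of_nonneg_left hsum hB₀) hwb
    _ = B₀ * β * (w 1 b * ∑ c, Real.exp (-(δ₀ / 2 * dBI b c)) * (dBI b c + 1) * (F.L : ℝ) ^ ((K - n) - (c.1.1 : ℕ))) := by ring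
    _ ≤ B₀ * β * B₃ := mul_le_mul_of_nonneg_left (h162 b) (mul_nonneg hB₀ hβ)
    _ = B₀ * B₃ * β := by ring

/-- **(161) IN P2's LETTERS — THE FOUR ROWS**: for the canonical flat `H` of the family `D` with the registered letters `HDecayLetterD dBI w H B₀ δ₀` ((161)₁)
and `RowSum162 dBI w δ₀ B₃` ((162)), a fine bond `b` with `0 ≤ w₁(b)` and a datum `X` obeying the effective bound at `b`
(`effDatum_of_near_far`), the four left-weighted quantities of (161)/(164) are `≤ B₀·B₃·β`:
`|HX|`, `∇^η HX` (three directions), `∂^{η*}∂^η HX`, `Δ^η HX` in the text's normalisations. [cite: Balaban1985Variational, (161)–(162) p.303] -/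
theorem rows164_of_hDecayLetterD {dBI : PBond (F.P K) 0 → BondIdx D → ℝ} {w : ℕ → PBond (F.P K) 0 → ℝ}
    {H : (BondIdx D → ℝ) →ₗ[ℝ] (PBond (F.P K) 0 → ℝ)} {δ₀ B₀ B₃ β : ℝ}
    (hH : HDecayLetterD F n K D dBI w H B₀ δ₀) (h162 : RowSum162 F n K D dBI w δ₀ B₃) (hB₀ : 0 ≤ B₀) (hβ : 0 ≤ β)
    {X : BondIdx D → ℝ} {b : PBond (F.P K) 0} (hwb : 0 ≤ w 1 b)
    (hX : ∀ c : BondIdx D, Real.exp (-(δ₀ / 2 * dBI b c)) * |X c| ≤ β * ((dBI b c + 1) * (F.L : ℝ) ^ ((K - n) - (c.1.1 : ℕ)))) :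
    w 1 b * (w 1 b * |H X b|) ≤ B₀ * B₃ * β ∧
    (∀ ν : Fin 3, w 1 b * (w 2 b * (F.L : ℝ) ^ (K - n) * |H X ⟨b.src.shift ν, b.dir⟩ - H X b|) ≤ B₀ * B₃ * β) ∧
    w 1 b * (w 3 b * |(dcsE ((F.L : ℝ) ^ (K - n)) (dcE ((F.L : ℝ) ^ (K - n)) (WithLp.toLp 2 (H X)))) b|) ≤ B₀ * B₃ * β ∧
    w 1 b * (w 3 b * ((F.L : ℝ) ^ (K - n)) ^ 2 *
        |∑ ν : Fin 3, ((H X b - H X ⟨b.src.shift ν, b.dir⟩) + (H X b - H X ⟨b.src.unshift ν, b.dir⟩))|) ≤ B₀ * B₃ * β := by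
  obtain ⟨h1, h2, h3, h4⟩ := hH X b
  exact ⟨row_le_of_kernel h162 hB₀ hβ hwb hX h1, fun ν => row_le_of_kernel h162 hB₀ hβ hwb hX (h2 ν),
    row_le_of_kernel h162 hB₀ hβ hwb hX h3, row_le_of_kernel h162 hB₀ hβ hwb hX h4⟩

end Carrier

/-! ## §4 (162)–(163) ⇒ (164): the quarter -/

/-- **(162)–(163) ⇒ (164), THE ARITHMETIC**: with print's constant `B₃′ = 4·C·B₀·B₃` (`B₃` = the row-sum bound of `RowSum162`, `C ≥ 0` the datum constant —
print's `18d³L³`), the effective size `β = C·M_Δ·max{ε₁, θε₀}` and (163) `B₃′θ ≤ ½` (`θ = e^{−½δ₀R₁M₁}`), `0 ≤ B₀, B₃, M_Δ, ε₀`: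
`B₀·B₃·β ≤ ¼M_Δ·max{B₃′ε₁, ½ε₀}`. [cite: Balaban1985Variational, (162)–(164) pp.303–304] -/
theorem quarter164_arith {B₀ B₃ C MΔ ε₁ ε₀ θ : ℝ} (hB₀ : 0 ≤ B₀) (hB₃ : 0 ≤ B₃) (hC : 0 ≤ C) (hM : 0 ≤ MΔ) (hε₀ : 0 ≤ ε₀)
    (h163 : 4 * C * B₀ * B₃ * θ ≤ 1 / 2) :
    B₀ * B₃ * (C * MΔ * max ε₁ (θ * ε₀)) ≤ 1 / 4 * MΔ * max (4 * C * B₀ * B₃ * ε₁) (ε₀ / 2) := by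
  have hK : 0 ≤ 4 * C * B₀ * B₃ := by positivity
  have hmax : 4 * C * B₀ * B₃ * max ε₁ (θ * ε₀) ≤ max (4 * C * B₀ * B₃ * ε₁) (ε₀ / 2) := by
    rcases le_total ε₁ (θ * ε₀) with h | h
    · rw [max_eq_right h]
      calc 4 * C * B₀ * B₃ * (θ * ε₀) = (4 * C * B₀ * B₃ * θ) * ε₀ := by ring
        _ ≤ 1 / 2 * ε₀ := mul_le_mul_of_nonneg_right h163 hε₀
        _ = ε₀ / 2 := by ring
        _ ≤ max (4 * C * B₀ * B₃ * ε₁) (ε₀ / 2) := le_max_right _ _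
    · rw [max_eq_left h]
      exact le_max_left _ _
  calc B₀ * B₃ * (C * MΔ * max ε₁ (θ * ε₀)) = 1 / 4 * MΔ * (4 * C * B₀ * B₃ * max ε₁ (θ * ε₀)) := by ring
    _ ≤ 1 / 4 * MΔ * max (4 * C * B₀ * B₃ * ε₁) (ε₀ / 2) := mul_le_mul_of_nonneg_left hmax (by positivity)

section Quarter

variable {F : T3Family} {n K : ℕ} {D : Domains (F.P K)}

/-- **(164) IN P2's LETTERS** (§3 + §4): `HDecayLetterD` ∧ `RowSum162` ∧ NEAR datum `|X(c)| ≤ C·M_Δ·ε₁·(d+1)L^{…}` ((160)) ∧ FAR datum `|X(c)| ≤ C·M_Δ·ε₀·L^{…}`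
at distance `≥ R₁M₁` ((155), (144)) ∧ (163) `4CB₀B₃e^{−½δ₀R₁M₁} ≤ ½` ⇒ the four left-weighted rows at `b` are `≤ ¼M_Δ·max{B₃′ε₁, ½ε₀}`, `B₃′ = 4CB₀B₃`.
[cite: Balaban1985Variational, (160)–(164) pp.303–304] -/
theorem rows164_quarter {dBI : PBond (F.P K) 0 → BondIdx D → ℝ} {w : ℕ → PBond (F.P K) 0 → ℝ}
    {H : (BondIdx D → ℝ) →ₗ[ℝ] (PBond (F.P K) 0 → ℝ)} {δ₀ B₀ B₃ C MΔ ε₁ ε₀ R₁M₁ : ℝ}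
    (hH : HDecayLetterD F n K D dBI w H B₀ δ₀) (h162 : RowSum162 F n K D dBI w δ₀ B₃) (hδ₀ : 0 ≤ δ₀) (hB₀ : 0 ≤ B₀) (hB₃ : 0 ≤ B₃)
    (hC : 0 ≤ C) (hM : 0 ≤ MΔ) (hε₁ : 0 ≤ ε₁) (hε₀ : 0 ≤ ε₀)
    (h163 : 4 * C * B₀ * B₃ * Real.exp (-(δ₀ / 2 * R₁M₁)) ≤ 1 / 2)
    (near : BondIdx D → Prop) {X : BondIdx D → ℝ} {b : PBond (F.P K) 0} (hwb : 0 ≤ w 1 b) (hd : ∀ c, 0 ≤ dBI b c)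
    (hnear : ∀ c, near c → |X c| ≤ C * MΔ * ε₁ * ((dBI b c + 1) * (F.L : ℝ) ^ ((K - n) - (c.1.1 : ℕ))))
    (hfar : ∀ c, ¬ near c → |X c| ≤ C * MΔ * ε₀ * (F.L : ℝ) ^ ((K - n) - (c.1.1 : ℕ)) ∧ R₁M₁ ≤ dBI b c) :
    w 1 b * (w 1 b * |H X b|) ≤ 1 / 4 * MΔ * max (4 * C * B₀ * B₃ * ε₁) (ε₀ / 2) ∧
    (∀ ν : Fin 3, w 1 b * (w 2 b * (F.L : ℝ) ^ (K - n) * |H X ⟨b.src.shift ν, b.dir⟩ - H X b|) ≤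
      1 / 4 * MΔ * max (4 * C * B₀ * B₃ * ε₁) (ε₀ / 2)) ∧
    w 1 b * (w 3 b * |(dcsE ((F.L : ℝ) ^ (K - n)) (dcE ((F.L : ℝ) ^ (K - n)) (WithLp.toLp 2 (H X)))) b|) ≤
      1 / 4 * MΔ * max (4 * C * B₀ * B₃ * ε₁) (ε₀ / 2) ∧
    w 1 b * (w 3 b * ((F.L : ℝ) ^ (K - n)) ^ 2 *
        |∑ ν : Fin 3, ((H X b - H X ⟨b.src.shift ν, b.dir⟩) + (H X b - H X ⟨b.src.unshift ν, b.dir⟩))|) ≤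
      1 / 4 * MΔ * max (4 * C * B₀ * B₃ * ε₁) (ε₀ / 2) := by
  -- the effective datum with β = max{CM_Δε₁, θ·CM_Δε₀} = CM_Δ·max{ε₁, θε₀}
  set θ : ℝ := Real.exp (-(δ₀ / 2 * R₁M₁)) with hθ
  have hθ0 : 0 ≤ θ := Real.exp_nonneg _
  have hβ₂ : 0 ≤ C * MΔ * ε₀ := by positivity
  have hX := effDatum_of_near_far dBI hδ₀ hβ₂ near X b hd hnear hfar
  have hβeq : max (C * MΔ * ε₁) (θ * (C * MΔ * ε₀)) = C * MΔ * max ε₁ (θ * ε₀) := by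
    have hcm : 0 ≤ C * MΔ := by positivity
    rw [show θ * (C * MΔ * ε₀) = C * MΔ * (θ * ε₀) by ring, ← mul_max_of_nonneg _ _ hcm]
  rw [hβeq] at hX
  have hβ : 0 ≤ C * MΔ * max ε₁ (θ * ε₀) := mul_nonneg (by positivity) (le_max_of_le_left hε₁)
  obtain ⟨r1, r2, r3, r4⟩ := rows164_of_hDecayLetterD hH h162 hB₀ hβ hwb hX
  have hq := quarter164_arith (ε₁ := ε₁) hB₀ hB₃ hC hM hε₀ h163
  exact ⟨r1.trans hq, fun ν => (r2 ν).trans hq, r3.trans hq, r4.trans hq⟩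

end Quarter

end Summit.QuantumFields.YangMills.Theorems.FlatHBBound164

end
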